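import Literature.Analysis.Asymptotics.LogarithmicSummabilityTauberianIntegralProofs
import Summits.QuantumFields.BalabanUV.Beta.EriceFlowEnclosureLogMeanClockIntegralEnd
import Summits.QuantumFields.BalabanUV.Beta.EriceFlowEnclosureLogScaleAverage

/-!
# Beta / EriceFlowEnclosureLogScalePowerScales — THE HONEST TAUBERIAN CLASS OF THE LOG-SCALE AVERAGE AT 0⁺ IS POWER-SCALE SLOW DECREASE
# (Móricz 2013 Cor. 1 BY NAME — the tree's PROVED fact `Literature.Analysis.Asymptotics.Moricz2013_corollary1_holds`), the continuous twin of
# P2 #54i, and BY P2 #55c THE SAME CLASS SERVES THE LOGARITHMIC CUTOFF AVERAGE ALONG EVERY TWO-LOOP CLOCK: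
#     M continuous on ]0, δ[, `0 < c < δ`, M slowly decreasing on the POWER SCALES at 0⁺ (for every ε > 0 there are y₀ > 1, λ > 1 with
#     `M(c∕u) − M(c∕y) ≥ −ε` whenever `y₀ ≤ y < u ≤ y^λ` — i.e. from the coupling `h = c∕y` down to `c^{1−λ}h^λ`), and
#     `(∫_h^c M ds∕s)∕log(c∕h) → m` as h → 0⁺   ⟹   **`M → m` at 0⁺**;
# hence for M also bounded and log-Lipschitz and ANY clock `n·h_n → L₀ > 0`: `(Σ_{n<N} M(h_n)∕(n+1))∕H_N → m ⟹ M → m` (P2 #55c END), and in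
# the class all four statements — logarithmic cutoff average → m, samples → m, M → m, log-scale average → m — are equivalent; while P2 #54j's
# escaping witness `sin(log s)` is, as it must be, OUTSIDE the class (for every c).  Pure bookkeeping over a PROVED Literature fact + [folklore];
# by name over P2 #55a `integral_comp_div_div_eq` (the (L,1) mean of `y ↦ M(c∕y)` at t IS the log-scale average at h = c∕t), P2 #55c
# `logCutoffAverage_iff_logScaleAverage`, P2 #54j `logScaleAverage_of_tendsto` ∕ `sin_log_logScaleAverage_tendsto_zero` ∕ `sin_log_not_tendsto`,
# P2 #53b `tendsto_sampled_iff`-type facts are not needed.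
# (β-flow team, prover 2 = lower ∕ positivity side, unit `b2b-balaban-beta-bflow-p2`, gen 38; module P2 #55d; no Erice sentence occurs)

HONEST FRAMING (page 1 of everything the β sub-cell writes): discharging `BetaPertH` makes Bałaban's UV stability UNCONDITIONAL — a
real constructive-QFT result; it is NOT the continuum limit and NOT the Clay problem.  HONEST DEPENDENCY (cell reorg 2026-08-19,
verbatim): «continuum YM on T⁴ ⇐ BetaPertH ∧ nine spine estimates (0/9 proved); BetaPertH ⇐ (D1) ∧ (D4) ∧ CAP+tail; G-an2-4 gates
asym, D1 and NE2/3/4.»  THIS MODULE DISCHARGES NOTHING and quotes nothing: the Tauberian theorem is the tree's PROVED fact (F. Móricz, Studia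
Math. 219 (2013) 109–121, Cor. 1; proof module `Literature/Analysis/Asymptotics/LogarithmicSummabilityTauberianIntegralProofs.lean`), here
transported from t → ∞ to the coupling h = c∕t → 0⁺; [folklore] bookkeeping otherwise.  «cutoff average ∕ datum» are OUR READINGS of (3.76)'s O(1) term.

WHAT THIS FILE PROVES (0 sorry, 0 def): §1 `comp_intervalIntegrable`, `moriczMean_eq_logScaleAverage`,
**`tendsto_of_logScaleAverage_powerScaleSlowlyDecreasing`**, **`logScaleAverage_iff_tendsto_of_powerScaleSlowlyDecreasing`**;
§2 **`tendsto_of_logCutoffAverage_powerScaleSlowlyDecreasing`**, **`logCutoffAverage_iff_tendsto_of_powerScaleSlowlyDecreasing`**;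
§3 **`sin_log_not_powerScaleSlowlyDecreasing`**; §4 ⟦v1.1⟧ `powerScaleSD_of_tendsto` (necessity: a convergent M is in the class),
**`tendsto_iff_logScaleAverage_and_powerScaleSD`** (`M → m ⟺ log-scale average → m ∧ class` — necessary and sufficient).
NOT CLAIMED: that a β-flow
datum M (the three-loop Cesàro mean) IS in the class — nothing in rows L119–L154 supplies power-scale slow decrease, and the log-Lipschitz shape
does not (§3 ∕ P2 #54i); `BetaPertH`; continuum; Clay.
-/

namespace Summit.QuantumFields.BalabanUV.Beta.EriceFlowEnclosureLogScalePowerScales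

open Set Filter Topology MeasureTheory intervalIntegral
open Literature.Analysis.Asymptotics (Moricz2013_corollary1_holds)
open Summit.QuantumFields.BalabanUV.Beta.EriceFlowEnclosureCesaroClockHarmonic (comp_continuousOn)
open Summit.QuantumFields.BalabanUV.Beta.EriceFlowEnclosureLogMeanClockIntegral (integral_comp_div_div_eq)
open Summit.QuantumFields.BalabanUV.Beta.EriceFlowEnclosureLogMeanClockIntegralEnd (logCutoffAverage_iff_logScaleAverage)
open Summit.QuantumFields.BalabanUV.Beta.EriceFlowEnclosureLogScaleAverage
  (logScaleAverage_of_tendsto sin_log_logScaleAverage_tendsto_zero sin_log_not_tendsto)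

noncomputable section

variable {M : ℝ → ℝ} {δ C B L₀ : ℝ}

/-! ## §1 Móricz Cor. 1 at 0⁺: the log-scale average in the power-scale class -/

/-- `y ↦ M(c∕y)` is interval integrable on every [1, t] (t ≥ 1) when M is continuous on ]0, δ[ and 0 < c < δ (it is continuous there:
`c∕y ∈ ]0, c] ⊂ ]0, δ[`). [folklore] -/
theorem comp_intervalIntegrable (hcont : ContinuousOn M (Ioo 0 δ)) {c : ℝ} (hc0 : 0 < c) (hcδ : c < δ)
    {t : ℝ} (ht : 1 ≤ t) : IntervalIntegrable (fun y => M (c / y)) volume 1 t := by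
  have hδ : 0 < δ := hc0.trans hcδ
  have hcδ1 : c / δ < 1 := by rw [div_lt_one hδ]; exact hcδ
  refine ((comp_continuousOn hδ hc0 hcont).mono fun y hy => ?_).intervalIntegrable
  rw [uIcc_of_le ht] at hy
  exact lt_of_lt_of_le hcδ1 hy.1

/-- **MÓRICZ'S (L,1) MEAN OF `y ↦ M(c∕y)` IS THE LOG-SCALE AVERAGE AT THE COUPLING `h = c∕t`**:
`(∫_1^t M(c∕y) dy∕y)∕log t = (∫_{c∕t}^{c} M ds∕s)∕log(c∕(c∕t))` for t ≥ 1 (P2 #55a `integral_comp_div_div_eq`). [folklore] -/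
theorem moriczMean_eq_logScaleAverage (hcont : ContinuousOn M (Ioo 0 δ)) {c : ℝ} (hc0 : 0 < c) (hcδ : c < δ)
    {t : ℝ} (ht : 1 ≤ t) :
    (∫ y in (1:ℝ)..t, M (c / y) / y) / Real.log t = (∫ s in (c / t)..c, M s / s) / Real.log (c / (c / t)) := by
  rw [integral_comp_div_div_eq hc0 hcont one_pos ht (by rwa [div_one]), div_one, div_div_cancel₀ hc0.ne']

/-- **THE TAUBERIAN CLASS OF THE LOG-SCALE AVERAGE AT 0⁺ (Móricz 2013 Cor. 1 BY NAME).**  M continuous on ]0, δ[, `0 < c < δ`; M SLOWLY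
DECREASING ON THE POWER SCALES at 0⁺: for every ε > 0 there are y₀ > 1 and l > 1 with `M(c∕u) − M(c∕y) ≥ −ε` whenever `y₀ ≤ y < u ≤ y^l`;
and the log-scale average `(∫_h^c M ds∕s)∕log(c∕h) → m` as h → 0⁺.  Then **`M → m` at 0⁺**.  (The tree's proved fact, transported by
`y = c∕h`: its (L,1) mean of `y ↦ M(c∕y)` is the log-scale average at `c∕t`, and `c∕(c∕h) = h`.) -/
theorem tendsto_of_logScaleAverage_powerScaleSlowlyDecreasing (hcont : ContinuousOn M (Ioo 0 δ)) {c : ℝ} (hc0 : 0 < c) (hcδ : c < δ)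
    (hsd : ∀ ε : ℝ, 0 < ε → ∃ (y₀ l : ℝ), 1 < y₀ ∧ 1 < l ∧
      ∀ y u : ℝ, y₀ ≤ y → y < u → u ≤ y ^ l → -ε ≤ M (c / u) - M (c / y))
    {m : ℝ} (havg : Tendsto (fun h => (∫ s in h..c, M s / s) / Real.log (c / h)) (𝓝[>] 0) (𝓝 m)) :
    Tendsto M (𝓝[>] 0) (𝓝 m) := by
  -- c/h → ∞ as h → 0⁺ and c/t → 0⁺ as t → ∞
  have hup : Tendsto (fun h : ℝ => c / h) (𝓝[>] 0) atTop :=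
    Tendsto.const_mul_atTop hc0 tendsto_inv_nhdsGT_zero |>.congr fun x => by rw [div_eq_mul_inv]
  have hdown : Tendsto (fun t : ℝ => c / t) atTop (𝓝[>] 0) := by
    refine tendsto_nhdsWithin_iff.mpr ⟨tendsto_const_nhds.div_atTop tendsto_id, ?_⟩
    · filter_upwards [eventually_gt_atTop 0] with t ht
      exact div_pos hc0 ht
  -- the (L,1) summability of s(y) = M(c/y)
  have hL1 : Tendsto (fun t : ℝ => (∫ y in (1:ℝ)..t, (fun y => M (c / y)) y / y) / Real.log t) atTop (𝓝 m) := by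
    have h1 := havg.comp hdown
    refine h1.congr' ?_
    filter_upwards [eventually_ge_atTop 1] with t ht
    simp only [Function.comp_apply]
    exact (moriczMean_eq_logScaleAverage hcont hc0 hcδ ht).symm
  have hs := Moricz2013_corollary1_holds (fun y => M (c / y)) m
    (fun t ht => comp_intervalIntegrable hcont hc0 hcδ ht) hsd hL1
  -- back to 0⁺: M h = s(c/h)
  have h2 := hs.comp hup
  refine h2.congr' ?_
  filter_upwards [self_mem_nhdsWithin] with h hh
  simp only [Function.comp_apply]
  rw [div_div_cancel₀ hc0.ne']

/-- IN THE POWER-SCALE CLASS THE LOG-SCALE AVERAGE IS EXACT: M continuous on ]0, δ[, `0 < c < δ`, M slowly decreasing on the power scales at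
0⁺ (as above); then for every m: **`(∫_h^c M ds∕s)∕log(c∕h) → m ⟺ M → m` at 0⁺** (⟸ is regularity, P2 #54j `logScaleAverage_of_tendsto`).
[folklore] over the proved fact. -/
theorem logScaleAverage_iff_tendsto_of_powerScaleSlowlyDecreasing (hcont : ContinuousOn M (Ioo 0 δ)) {c : ℝ} (hc0 : 0 < c)
    (hcδ : c < δ)
    (hsd : ∀ ε : ℝ, 0 < ε → ∃ (y₀ l : ℝ), 1 < y₀ ∧ 1 < l ∧
      ∀ y u : ℝ, y₀ ≤ y → y < u → u ≤ y ^ l → -ε ≤ M (c / u) - M (c / y)) (m : ℝ) :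
    Tendsto (fun h => (∫ s in h..c, M s / s) / Real.log (c / h)) (𝓝[>] 0) (𝓝 m) ↔ Tendsto M (𝓝[>] 0) (𝓝 m) :=
  ⟨fun havg => tendsto_of_logScaleAverage_powerScaleSlowlyDecreasing hcont hc0 hcδ hsd havg,
    fun hM => logScaleAverage_of_tendsto hc0 (hcont.mono fun _ hs => ⟨hs.1, lt_of_le_of_lt hs.2 hcδ⟩) hM⟩

/-! ## §2 Along any two-loop clock: the same class serves the logarithmic cutoff average -/

/-- **THE LOGARITHMIC CUTOFF AVERAGE IN THE POWER-SCALE CLASS.**  M continuous on ]0, δ[ with `|M| ≤ B` and `|M u − M t| ≤ C·log(u∕t)`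
(0 < t ≤ u < δ; C ≥ 0), slowly decreasing on the power scales at 0⁺ (normalised at c, `0 < c < δ`); `h_n > 0` with `n·h_n → L₀ > 0`.  Then
**`(Σ_{n<N} M(h_n)∕(n+1))∕H_N → m ⟹ M → m` at 0⁺** (P2 #55c: the logarithmic cutoff average is the log-scale average; §1). -/
theorem tendsto_of_logCutoffAverage_powerScaleSlowlyDecreasing (hδ : 0 < δ) (hC : 0 ≤ C) (hcont : ContinuousOn M (Ioo 0 δ))
    (hlip : ∀ t u : ℝ, 0 < t → t ≤ u → u < δ → |M u - M t| ≤ C * Real.log (u / t))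
    (hB : ∀ s ∈ Ioo 0 δ, |M s| ≤ B) {h : ℕ → ℝ} (hpos : ∀ n, 0 < h n) (hL₀ : 0 < L₀)
    (hclock : Tendsto (fun n : ℕ => (n : ℝ) * h n) atTop (𝓝 L₀)) {c : ℝ} (hc0 : 0 < c) (hcδ : c < δ)
    (hsd : ∀ ε : ℝ, 0 < ε → ∃ (y₀ l : ℝ), 1 < y₀ ∧ 1 < l ∧
      ∀ y u : ℝ, y₀ ≤ y → y < u → u ≤ y ^ l → -ε ≤ M (c / u) - M (c / y))
    {m : ℝ} (havg : Tendsto (fun N : ℕ => (∑ n ∈ Finset.range N, ((n : ℝ) + 1)⁻¹ * M (h n)) /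
      (∑ n ∈ Finset.range N, ((n : ℝ) + 1)⁻¹)) atTop (𝓝 m)) :
    Tendsto M (𝓝[>] 0) (𝓝 m) :=
  tendsto_of_logScaleAverage_powerScaleSlowlyDecreasing hcont hc0 hcδ hsd
    ((logCutoffAverage_iff_logScaleAverage hδ hC hcont hlip hB hpos hL₀ hclock hc0 hcδ m).mp havg)

/-- IN THE POWER-SCALE CLASS, ALONG ANY CLOCK, ALL FOUR ARE ONE: for every m,
**`(Σ_{n<N} M(h_n)∕(n+1))∕H_N → m ⟺ M → m at 0⁺`** (and both ⟺ the log-scale average → m, §1; ⟺ the samples `M(h_n) → m`, P2 #53b). -/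
theorem logCutoffAverage_iff_tendsto_of_powerScaleSlowlyDecreasing (hδ : 0 < δ) (hC : 0 ≤ C) (hcont : ContinuousOn M (Ioo 0 δ))
    (hlip : ∀ t u : ℝ, 0 < t → t ≤ u → u < δ → |M u - M t| ≤ C * Real.log (u / t))
    (hB : ∀ s ∈ Ioo 0 δ, |M s| ≤ B) {h : ℕ → ℝ} (hpos : ∀ n, 0 < h n) (hL₀ : 0 < L₀)
    (hclock : Tendsto (fun n : ℕ => (n : ℝ) * h n) atTop (𝓝 L₀)) {c : ℝ} (hc0 : 0 < c) (hcδ : c < δ)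
    (hsd : ∀ ε : ℝ, 0 < ε → ∃ (y₀ l : ℝ), 1 < y₀ ∧ 1 < l ∧
      ∀ y u : ℝ, y₀ ≤ y → y < u → u ≤ y ^ l → -ε ≤ M (c / u) - M (c / y)) (m : ℝ) :
    Tendsto (fun N : ℕ => (∑ n ∈ Finset.range N, ((n : ℝ) + 1)⁻¹ * M (h n)) /
        (∑ n ∈ Finset.range N, ((n : ℝ) + 1)⁻¹)) atTop (𝓝 m) ↔ Tendsto M (𝓝[>] 0) (𝓝 m) := by
  rw [logCutoffAverage_iff_logScaleAverage hδ hC hcont hlip hB hpos hL₀ hclock hc0 hcδ m]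
  exact logScaleAverage_iff_tendsto_of_powerScaleSlowlyDecreasing hcont hc0 hcδ hsd m

/-! ## §3 The escaping witness is outside the class -/

/-- **P2 #54j's WITNESS `sin(log s)` IS NOT SLOWLY DECREASING ON THE POWER SCALES at 0⁺** (for any normalisation c > 0): its log-scale average
tends to 0 while it has no limit at 0⁺ (P2 #54j), which §1 forbids inside the class.  So the logarithmic escape of gen 37 (P2 #54f∕#54g∕#54j)
lives exactly in the gap between the two-loop clock's class (log-Lipschitz ⟹ slowly oscillating on the ORDINARY scales) and the logarithmic
method's class (power scales) — on the continuous side as on the discrete side (P2 #54i `witness_not_powerScaleSlowlyDecreasing`). [folklore] -/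
theorem sin_log_not_powerScaleSlowlyDecreasing {c : ℝ} (hc0 : 0 < c) :
    ¬ (∀ ε : ℝ, 0 < ε → ∃ (y₀ l : ℝ), 1 < y₀ ∧ 1 < l ∧
      ∀ y u : ℝ, y₀ ≤ y → y < u → u ≤ y ^ l →
        -ε ≤ Real.sin (Real.log (c / u)) - Real.sin (Real.log (c / y))) := by
  intro hsd
  have hcont : ContinuousOn (fun s : ℝ => Real.sin (Real.log s)) (Ioo 0 (c + 1)) :=
    Real.continuous_sin.comp_continuousOn (Real.continuousOn_log.mono fun s hs => hs.1.ne')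
  have h := tendsto_of_logScaleAverage_powerScaleSlowlyDecreasing (M := fun s => Real.sin (Real.log s)) hcont hc0
    (by linarith) hsd (sin_log_logScaleAverage_tendsto_zero hc0)
  exact sin_log_not_tendsto ⟨0, h⟩

/-! ## §4 ⟦v1.1⟧ Necessity: a convergent M is in the class, so the class is necessary and sufficient -/

/-- **⟦v1.1⟧ NECESSITY (trivial half of Móricz's «necessary and sufficient»)**: if `M → m` at 0⁺ then M is slowly decreasing on the power scales
at 0⁺ (normalised at any c > 0) — indeed `|M(c∕u) − M(c∕y)| < ε` for all large y < u, whatever the scale. [folklore] -/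
theorem powerScaleSD_of_tendsto {c : ℝ} (hc0 : 0 < c) {m : ℝ} (hM : Tendsto M (𝓝[>] 0) (𝓝 m)) :
    ∀ ε : ℝ, 0 < ε → ∃ (y₀ l : ℝ), 1 < y₀ ∧ 1 < l ∧
      ∀ y u : ℝ, y₀ ≤ y → y < u → u ≤ y ^ l → -ε ≤ M (c / u) - M (c / y) := by
  intro ε hε
  have hdown : Tendsto (fun t : ℝ => c / t) atTop (𝓝[>] 0) := by
    refine tendsto_nhdsWithin_iff.mpr ⟨tendsto_const_nhds.div_atTop tendsto_id, ?_⟩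
    filter_upwards [eventually_gt_atTop 0] with t ht
    exact div_pos hc0 ht
  have h := Metric.tendsto_atTop.mp (hM.comp hdown) (ε / 2) (by positivity)
  obtain ⟨Y, hY⟩ := h
  refine ⟨max Y 2, 2, by linarith [le_max_right Y 2], by norm_num, fun y u hy hyu _ => ?_⟩
  have hyY : Y ≤ y := (le_max_left _ _).trans hy
  have h1 := hY y hyY
  have h2 := hY u (hyY.trans hyu.le)
  simp only [Function.comp_apply, Real.dist_eq] at h1 h2
  rw [abs_lt] at h1 h2
  linarith [h1.1, h1.2, h2.1, h2.2]

/-- **⟦v1.1⟧ NECESSARY AND SUFFICIENT**: M continuous on ]0, δ[, `0 < c < δ`; then for every m: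
**`M → m` at 0⁺ ⟺ (the log-scale average `(∫_h^c M ds∕s)∕log(c∕h) → m` at 0⁺ ∧ M is slowly decreasing on the power scales at 0⁺)** — the
power-scale class is exactly what the log-scale average needs, no more (⟹: regularity P2 #54j + `powerScaleSD_of_tendsto`; ⟸: §1). [folklore]
over the proved fact. -/
theorem tendsto_iff_logScaleAverage_and_powerScaleSD (hcont : ContinuousOn M (Ioo 0 δ)) {c : ℝ} (hc0 : 0 < c) (hcδ : c < δ) (m : ℝ) :
    Tendsto M (𝓝[>] 0) (𝓝 m) ↔
      (Tendsto (fun h => (∫ s in h..c, M s / s) / Real.log (c / h)) (𝓝[>] 0) (𝓝 m) ∧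
        ∀ ε : ℝ, 0 < ε → ∃ (y₀ l : ℝ), 1 < y₀ ∧ 1 < l ∧
          ∀ y u : ℝ, y₀ ≤ y → y < u → u ≤ y ^ l → -ε ≤ M (c / u) - M (c / y)) :=
  ⟨fun hM => ⟨logScaleAverage_of_tendsto hc0 (hcont.mono fun _ hs => ⟨hs.1, lt_of_le_of_lt hs.2 hcδ⟩) hM,
      powerScaleSD_of_tendsto hc0 hM⟩,
    fun h => tendsto_of_logScaleAverage_powerScaleSlowlyDecreasing hcont hc0 hcδ h.2 h.1⟩

end

end Summit.QuantumFields.BalabanUV.Beta.EriceFlowEnclosureLogScalePowerScales
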